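import Mathlib
import HarnessLib
import Summits.HubbardSuperconductivity.HubbardSuperconductivity.Theorems.KLProgrammeKLRegimeSplitBundleV14
import Summits.HubbardSuperconductivity.HubbardSuperconductivity.Theorems.KLProgrammeKLRegimeSplitTwoLegIncrementSizesFromPosition
import Summits.HubbardSuperconductivity.HubbardSuperconductivity.Theorems.KLProgrammeKLRegimeSplitTwoLegFrameLipschitzLiteral
import Summits.HubbardSuperconductivity.HubbardSuperconductivity.Theorems.KLProgrammeKLRegimeSplitTwoLegMomentsFromPosition
import Summits.HubbardSuperconductivity.HubbardSuperconductivity.Theorems.KLProgrammeKLRegimeSplitTwoLegPieceFnEval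
import Summits.HubbardSuperconductivity.HubbardSuperconductivity.Theorems.KLProgrammeKLRegimeSplitTwoLegFrameLipschitzIncrement

/-!
# Route `KLProgramme` — gen-5 ENGINE child (`EngineP4 klPredsV14 klWindowC`), stub `stub_twoLeg_step`: the slot core `TwoLegCoreT hist … K (n+1)`
# ASSEMBLED from the expansion's exports — ONE theorem, model inputs as hypotheses

Cell `gate-hubbard-kl`, seat p1b (g6).  `TwoLegCoreT hist … K n := TwoLegSizesT1Fn … K.eval n ∧ FrameLipschitzFnT hist … K n ∧ TwoLegSlopes … K n`
(`…SplitBundleV14` §1).  For the pieces `ℓ_{n+1}(K.eval)` every conjunct now has a generic closer in the tree; this file composes them into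
**`twoLegCoreT_succ_of_exports`**: for every `R` (`Gfr ≥ 0`) there are `c₃, U₀, D_lip, D_sl > 0` such that in the regime (`c ≤ c₃`, `U ≤ U₀`,
`klBetaMin ≤ β ≤ e^{c/U²}`), for `μ ∈ klWindowC` and an admissible `K`, for every history `hist`, packages `G P Q`, volumes and scale `n`, the following
MODEL-SIDE EXPORTS imply `TwoLegCoreT L M hist G P Q R β U μ K (n+1)`:
* (E3a-T1) the pinned spatial moments `Mˢ k` (`k ≤ 4`) of the INCREMENT `W^{(n+1)} − W^{(n)}` of the unsectorised position two-leg kernels, cutoff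
  numerals `X` (`l ≤ 2`), and the FIT of k3c3-p3's order-resolved bound into `twoLegBar G Q U j (n+1)` (`j ≤ 2`)
  [`twoLegPieceV13_tier1_size_le_of_position_moments`, p489770 = p488152 ∘ p486520; `ContDiff` from k3c3-p1's
  `twoLegPieceFn_eval_smooth_symmetric_of_frameOK`];
* (E3c-T) gradients `b_{n+1}, b_n` of `evalM S_m^K`, RESPONSE MODULI `ρ_{n+1}, ρ_n` against every admissible comparison frame with history, and the
  fit `(ρ_{n+1} + ρ_n) + (b_{n+1} + b_n)/D_lip ≤ lipBar G Q U (n+1)` [`frameLipschitzFnT_succ_of_responses`, p488419];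
* (E3d/e) the first spatial moment `Mˢ₁'` and the temporal first moment `Mᵗ` of `W^{(n+1)}` with `2Mˢ₁' ≤ cz|U|·D_sl`, `2Mᵗ ≤ cz|U|`
  [`twoLegSlopes_of_frameOK_regime_of_position_moments`, p485541].
v2 (appended) **`twoLegCoreT_succ_of_position_exports`**: the (E3c) block INCREMENT-RESOLVED and from position data only — the gradient is read off
`Mˢ 1`, the one new export is the pinned `L¹` frame-Lipschitz modulus `ρ_fr` of the increment kernel (`…TwoLegFrameLipschitzIncrement`, p491124);
use v2 for the fit at scales `n ≥ 1` (v1's separate responses/gradients are `O(U)` and do not fit `lipBar … (n+1) ∝ 4^{−n}`).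
Proof only (plumbing of landed closers); nothing about the model is asserted.  References: BGM 2006 (2.36), §2.4 [cite: BenfattoGiulianiMastropietro2006].
-/

noncomputable section

namespace Summit.HubbardSuperconductivity.HubbardSuperconductivity.Theorems.KLRegimeSplit

set_option linter.dupNamespace false -- summit = problem name (single-conjunct summit), D-0017

open Real Finset
open Literature.MathematicalPhysics.QuantumLattice Literature.Probability.LatticeModels
open Summit.HubbardSuperconductivity.HubbardSuperconductivity.Theorems.KLProgrammeLegKernels
open Summit.HubbardSuperconductivity.HubbardSuperconductivity.Theorems.PerturbedFermiCurve
open Summit.HubbardSuperconductivity.HubbardSuperconductivity.Theorems.TwoLegFourier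

/-- **`TwoLegCoreT hist … K (n+1)` FROM THE EXPANSION'S EXPORTS** (see the module docstring for the list; all fits are hypotheses). -/
theorem twoLegCoreT_succ_of_exports (R : RenConsts) (hR : ∀ j, 0 ≤ R.Gfr j) :
    ∃ c₃ : ℝ, 0 < c₃ ∧ ∃ U₀ : ℝ, 0 < U₀ ∧ ∃ Dlip : ℝ, 0 < Dlip ∧ ∃ Dsl : ℝ, 0 < Dsl ∧
      ∀ c : ℝ, 0 < c → c ≤ c₃ → ∀ U : ℝ, 0 < U → U ≤ U₀ → ∀ β : ℝ, klBetaMin ≤ β → β ≤ Real.exp (c / U ^ 2) →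
      ∀ μ ∈ klWindowC, ∀ K : TrigPolyC4v, FrameOK R U (nScales β) μ K →
        ∀ (L M : ℕ) [NeZero L] [NeZero M] (hist : TrigPolyC4v → ℕ → Prop) (G : GeoConsts) (P : SplitConsts) (Q : EngConsts) (n : ℕ)
          -- (E3a-T1) exports
          (Ms : ℕ → ℝ) (X : ℝ),
          (∀ k ≤ 4, ∀ (σ : Fin 2) (x₀ : SpaceTimeIdx L M), imagTimeWeight β M *
            ∑ x ∈ (univ : Finset (Fin 2 → SpaceTimeIdx L M)).filter (fun x => x 0 = x₀),
              (1 + ((((x 1).2 - (x 0).2) 0).valMinAbs.natAbs : ℝ) + ((((x 1).2 - (x 0).2) 1).valMinAbs.natAbs : ℝ)) ^ k *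
                ‖sectorisedKernel L M β (trivialMultiplier L M) (klEffectiveAction L M β U μ K klE0 (n + 1)) 2
                    (![((0, σ), 0), ((0, σ), 1)] : Fin 2 → SectorLeg 1) x -
                  sectorisedKernel L M β (trivialMultiplier L M) (klEffectiveAction L M β U μ K klE0 n) 2
                    (![((0, σ), 0), ((0, σ), 1)] : Fin 2 → SectorLeg 1) x‖ ≤ Ms k) →
          (∀ l ≤ 2, ∀ x : ℝ, ‖iteratedFDeriv ℝ l salmhoferCutoff x‖ ≤ X) →
          (∀ j ≤ 2, (if j = 0 then 2 * Ms 0 else 0) +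
              (j.factorial : ℝ) ^ 2 * (2 * j.factorial * X * 200 ^ j) *
                (if j = 0 then 2 * (2 * Ms 0) else (2 * π + 1) * (2 * Ms 1 * klCurveD1) +
                  (if j = 2 then 2 * Ms 2 * klCurveD1 ^ 2 + 2 * Ms 1 * klCurveD2 else 0)) *
                (4 + max 1 (((j - 1).factorial : ℝ) / (8 / 5))) ^ j ≤ twoLegBar G Q U j (n + 1)) →
          -- (E3c-T) exports
          ∀ (b₁ b₀ ρ₁ ρ₀ : ℝ), 0 ≤ b₁ → 0 ≤ b₀ →
          (∀ q : Momentum, ‖fderiv ℝ (evalM (symInterp L (klLocSelfEnergyRe L M β U μ K (n + 1)))) q‖ ≤ b₁) →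
          (∀ q : Momentum, ‖fderiv ℝ (evalM (symInterp L (klLocSelfEnergyRe L M β U μ K n))) q‖ ≤ b₀) →
          (∀ K' : TrigPolyC4v, FrameOK R U (klTempScaleIdx β klE0) μ K' → (∀ j < n + 1, hist K' j) → ∀ θ : ℝ,
            |(symInterp L (klLocSelfEnergyRe L M β U μ K (n + 1))).eval (klFermiPoint μ K' θ) -
              (symInterp L (klLocSelfEnergyRe L M β U μ K' (n + 1))).eval (klFermiPoint μ K' θ)| ≤ ρ₁ * frameDist K K') →
          (∀ K' : TrigPolyC4v, FrameOK R U (klTempScaleIdx β klE0) μ K' → (∀ j < n + 1, hist K' j) → ∀ θ : ℝ,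
            |(symInterp L (klLocSelfEnergyRe L M β U μ K n)).eval (klFermiPoint μ K' θ) -
              (symInterp L (klLocSelfEnergyRe L M β U μ K' n)).eval (klFermiPoint μ K' θ)| ≤ ρ₀ * frameDist K K') →
          (ρ₁ + ρ₀) + (b₁ + b₀) / Dlip ≤ lipBar G Q U (n + 1) →
          -- (E3d/e) exports at scale `n + 1`
          ∀ (Ms₁ Mt : ℝ), 0 ≤ Ms₁ →
          (∀ (σ : Fin 2) (x₀ : SpaceTimeIdx L M), imagTimeWeight β M *
            ∑ x ∈ (univ : Finset (Fin 2 → SpaceTimeIdx L M)).filter (fun x => x 0 = x₀),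
              (1 + ((((x 1).2 - (x 0).2) 0).valMinAbs.natAbs : ℝ) + ((((x 1).2 - (x 0).2) 1).valMinAbs.natAbs : ℝ)) ^ 1 *
                ‖sectorisedKernel L M β (trivialMultiplier L M) (klEffectiveAction L M β U μ K klE0 (n + 1)) 2
                  (![((0, σ), 0), ((0, σ), 1)] : Fin 2 → SectorLeg 1) x‖ ≤ Ms₁) →
          (∀ (σ : Fin 2) (x₀ : SpaceTimeIdx L M), imagTimeWeight β M *
            ∑ x ∈ (univ : Finset (Fin 2 → SpaceTimeIdx L M)).filter (fun x => x 0 = x₀),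
              imagTimeWeight β M * (circDist (2 * M) (x 0).1.val (x 1).1.val : ℝ) *
                ‖sectorisedKernel L M β (trivialMultiplier L M) (klEffectiveAction L M β U μ K klE0 (n + 1)) 2
                  (![((0, σ), 0), ((0, σ), 1)] : Fin 2 → SectorLeg 1) x‖ ≤ Mt) →
          2 * Ms₁ ≤ R.cz * |U| * Dsl → 2 * Mt ≤ R.cz * |U| →
            TwoLegCoreT L M hist G P Q R β U μ K (n + 1) := by
  -- the four constituent regime lemmas and their thresholds
  obtain ⟨c₁, hc₁, U₁, hU₁, hsm⟩ := twoLegPieceFn_eval_smooth_symmetric_of_frameOK R hR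
  obtain ⟨c₂, hc₂, U₂, hU₂, Dlip, hDlip, hlip⟩ := frameLipschitzFnT_succ_of_responses R hR
  obtain ⟨c₄, hc₄, U₄, hU₄, Dsl, hDsl, hsl⟩ := twoLegSlopes_of_frameOK_regime_of_position_moments R hR
  have hC3 := klCurveC3_pos hR
  have hU0 := klCurveU0_pos hR
  refine ⟨min (min c₁ c₂) (min c₄ (klCurveC3 R)), lt_min (lt_min hc₁ hc₂) (lt_min hc₄ hC3),
    min (min U₁ U₂) (min U₄ (klCurveU0 R)), lt_min (lt_min hU₁ hU₂) (lt_min hU₄ hU0), Dlip, hDlip, Dsl, hDsl, ?_⟩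
  intro c hc hcle U hU hUle β hβmin hβc μ hμ K hK L M _ _ hist G P Q n Ms X hMs hX hfitS b₁ b₀ ρ₁ ρ₀ hb₁ hb₀ hg₁ hg₀ hr₁ hr₀ hfitL
    Ms₁ Mt hMs₁0 hMs₁ hMt hfit1 hfit2
  have hc1 : c ≤ c₁ := hcle.trans ((min_le_left _ _).trans (min_le_left _ _))
  have hc2 : c ≤ c₂ := hcle.trans ((min_le_left _ _).trans (min_le_right _ _))
  have hc4 : c ≤ c₄ := hcle.trans ((min_le_right _ _).trans (min_le_left _ _))
  have hcC : c ≤ klCurveC3 R := hcle.trans ((min_le_right _ _).trans (min_le_right _ _))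
  have hU1 : U ≤ U₁ := hUle.trans ((min_le_left _ _).trans (min_le_left _ _))
  have hU2 : U ≤ U₂ := hUle.trans ((min_le_left _ _).trans (min_le_right _ _))
  have hU4 : U ≤ U₄ := hUle.trans ((min_le_right _ _).trans (min_le_left _ _))
  have hUC : U ≤ klCurveU0 R := hUle.trans ((min_le_right _ _).trans (min_le_right _ _))
  refine ⟨⟨?_, fun j hj q => ?_⟩, ?_, ?_⟩
  · -- `ContDiff ℝ 4 (onM ℓ_{n+1}(K.eval))`
    have h := hsm c hc hc1 U hU hU1 β hβmin hβc μ hμ μ K hK L M (n + 1)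
    exact_mod_cast h.2 4
  · -- tier 1, order-resolved, from position moments + the fit
    exact (twoLegPieceV13_tier1_size_le_of_position_moments (L := L) (M := M) hR hc hcC hU hUC hβmin hβc hμ hK n hMs hj (fun l hl x => hX l (hl.trans hj) x) q).trans
      (hfitS j hj)
  · -- `FrameLipschitzFnT hist … K (n+1)`
    exact hlip c hc hc2 U hU hU2 β hβmin hβc μ hμ K hK L M hist G Q n b₁ b₀ ρ₁ ρ₀ hb₁ hb₀ hg₁ hg₀ hr₁ hr₀ hfitL
  · -- `TwoLegSlopes … K (n+1)`
    exact hsl c hc hc4 U hU hU4 β hβmin hβc μ hμ K hK L M (n + 1) Ms₁ Mt hMs₁0 hMs₁ hMt hfit1 hfit2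

/-- **`TwoLegCoreT hist … K (n+1)` FROM POSITION-SPACE EXPORTS ONLY, INCREMENT-RESOLVED** (v2 of `twoLegCoreT_succ_of_exports`): the (E3c) inputs
are now (i) the gradient of the increment, which is READ OFF the same first moment `Mˢ 1` as the sizes, and (ii) ONE new export — the pinned `L¹`
frame-Lipschitz modulus `ρ_fr` of the increment kernel: `‖ΔW^K − ΔW^{K′}‖_{L¹,pinned} ≤ ρ_fr·frameDist K K′` for every admissible `K′` with history —
with the fit `2ρ_fr + 2Mˢ₁/D_lip ≤ lipBar G Q U (n+1)` (`…TwoLegFrameLipschitzIncrement`).  (E3a-T1) and (E3d/e) as in v1. -/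
theorem twoLegCoreT_succ_of_position_exports (R : RenConsts) (hR : ∀ j, 0 ≤ R.Gfr j) :
    ∃ c₃ : ℝ, 0 < c₃ ∧ ∃ U₀ : ℝ, 0 < U₀ ∧ ∃ Dlip : ℝ, 0 < Dlip ∧ ∃ Dsl : ℝ, 0 < Dsl ∧
      ∀ c : ℝ, 0 < c → c ≤ c₃ → ∀ U : ℝ, 0 < U → U ≤ U₀ → ∀ β : ℝ, klBetaMin ≤ β → β ≤ Real.exp (c / U ^ 2) →
      ∀ μ ∈ klWindowC, ∀ K : TrigPolyC4v, FrameOK R U (nScales β) μ K →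
        ∀ (L M : ℕ) [NeZero L] [NeZero M] (hist : TrigPolyC4v → ℕ → Prop) (G : GeoConsts) (P : SplitConsts) (Q : EngConsts) (n : ℕ)
          -- (E3a-T1) exports
          (Ms : ℕ → ℝ) (X : ℝ),
          (∀ k ≤ 4, ∀ (σ : Fin 2) (x₀ : SpaceTimeIdx L M), imagTimeWeight β M *
            ∑ x ∈ (univ : Finset (Fin 2 → SpaceTimeIdx L M)).filter (fun x => x 0 = x₀),
              (1 + ((((x 1).2 - (x 0).2) 0).valMinAbs.natAbs : ℝ) + ((((x 1).2 - (x 0).2) 1).valMinAbs.natAbs : ℝ)) ^ k *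
                ‖sectorisedKernel L M β (trivialMultiplier L M) (klEffectiveAction L M β U μ K klE0 (n + 1)) 2
                    (![((0, σ), 0), ((0, σ), 1)] : Fin 2 → SectorLeg 1) x -
                  sectorisedKernel L M β (trivialMultiplier L M) (klEffectiveAction L M β U μ K klE0 n) 2
                    (![((0, σ), 0), ((0, σ), 1)] : Fin 2 → SectorLeg 1) x‖ ≤ Ms k) →
          (∀ l ≤ 2, ∀ x : ℝ, ‖iteratedFDeriv ℝ l salmhoferCutoff x‖ ≤ X) →
          (∀ j ≤ 2, (if j = 0 then 2 * Ms 0 else 0) +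
              (j.factorial : ℝ) ^ 2 * (2 * j.factorial * X * 200 ^ j) *
                (if j = 0 then 2 * (2 * Ms 0) else (2 * π + 1) * (2 * Ms 1 * klCurveD1) +
                  (if j = 2 then 2 * Ms 2 * klCurveD1 ^ 2 + 2 * Ms 1 * klCurveD2 else 0)) *
                (4 + max 1 (((j - 1).factorial : ℝ) / (8 / 5))) ^ j ≤ twoLegBar G Q U j (n + 1)) →
          -- (E3c-T) export: the pinned L¹ frame-Lipschitz modulus of the increment kernel
          ∀ (ρfr : ℝ),
          (∀ K' : TrigPolyC4v, FrameOK R U (klTempScaleIdx β klE0) μ K' → (∀ j < n + 1, hist K' j) →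
            ∀ (σ : Fin 2) (x₀ : SpaceTimeIdx L M), imagTimeWeight β M *
              ∑ x ∈ (univ : Finset (Fin 2 → SpaceTimeIdx L M)).filter (fun x => x 0 = x₀),
                (1 + ((((x 1).2 - (x 0).2) 0).valMinAbs.natAbs : ℝ) + ((((x 1).2 - (x 0).2) 1).valMinAbs.natAbs : ℝ)) ^ 0 *
                  ‖sectorisedKernel L M β (trivialMultiplier L M)
                      ((klEffectiveAction L M β U μ K klE0 (n + 1) - klEffectiveAction L M β U μ K klE0 n) -
                        (klEffectiveAction L M β U μ K' klE0 (n + 1) - klEffectiveAction L M β U μ K' klE0 n)) 2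
                      (![((0, σ), 0), ((0, σ), 1)] : Fin 2 → SectorLeg 1) x‖ ≤ ρfr * frameDist K K') →
          2 * ρfr + 2 * Ms 1 / Dlip ≤ lipBar G Q U (n + 1) →
          -- (E3d/e) exports at scale `n + 1`
          ∀ (Ms₁ Mt : ℝ), 0 ≤ Ms₁ →
          (∀ (σ : Fin 2) (x₀ : SpaceTimeIdx L M), imagTimeWeight β M *
            ∑ x ∈ (univ : Finset (Fin 2 → SpaceTimeIdx L M)).filter (fun x => x 0 = x₀),
              (1 + ((((x 1).2 - (x 0).2) 0).valMinAbs.natAbs : ℝ) + ((((x 1).2 - (x 0).2) 1).valMinAbs.natAbs : ℝ)) ^ 1 *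
                ‖sectorisedKernel L M β (trivialMultiplier L M) (klEffectiveAction L M β U μ K klE0 (n + 1)) 2
                  (![((0, σ), 0), ((0, σ), 1)] : Fin 2 → SectorLeg 1) x‖ ≤ Ms₁) →
          (∀ (σ : Fin 2) (x₀ : SpaceTimeIdx L M), imagTimeWeight β M *
            ∑ x ∈ (univ : Finset (Fin 2 → SpaceTimeIdx L M)).filter (fun x => x 0 = x₀),
              imagTimeWeight β M * (circDist (2 * M) (x 0).1.val (x 1).1.val : ℝ) *
                ‖sectorisedKernel L M β (trivialMultiplier L M) (klEffectiveAction L M β U μ K klE0 (n + 1)) 2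
                  (![((0, σ), 0), ((0, σ), 1)] : Fin 2 → SectorLeg 1) x‖ ≤ Mt) →
          2 * Ms₁ ≤ R.cz * |U| * Dsl → 2 * Mt ≤ R.cz * |U| →
            TwoLegCoreT L M hist G P Q R β U μ K (n + 1) := by
  obtain ⟨c₁, hc₁, U₁, hU₁, hsm⟩ := twoLegPieceFn_eval_smooth_symmetric_of_frameOK R hR
  obtain ⟨c₂, hc₂, U₂, hU₂, Dlip, hDlip, hlip⟩ := frameLipschitzFnT_succ_of_increment_responses R hR
  obtain ⟨c₄, hc₄, U₄, hU₄, Dsl, hDsl, hsl⟩ := twoLegSlopes_of_frameOK_regime_of_position_moments R hR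
  have hC3 := klCurveC3_pos hR
  have hU0 := klCurveU0_pos hR
  refine ⟨min (min c₁ c₂) (min c₄ (klCurveC3 R)), lt_min (lt_min hc₁ hc₂) (lt_min hc₄ hC3),
    min (min U₁ U₂) (min U₄ (klCurveU0 R)), lt_min (lt_min hU₁ hU₂) (lt_min hU₄ hU0), Dlip, hDlip, Dsl, hDsl, ?_⟩
  intro c hc hcle U hU hUle β hβmin hβc μ hμ K hK L M _ _ hist G P Q n Ms X hMs hX hfitS ρfr hρ hfitL
    Ms₁ Mt hMs₁0 hMs₁ hMt hfit1 hfit2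
  have hc1 : c ≤ c₁ := hcle.trans ((min_le_left _ _).trans (min_le_left _ _))
  have hc2 : c ≤ c₂ := hcle.trans ((min_le_left _ _).trans (min_le_right _ _))
  have hc4 : c ≤ c₄ := hcle.trans ((min_le_right _ _).trans (min_le_left _ _))
  have hcC : c ≤ klCurveC3 R := hcle.trans ((min_le_right _ _).trans (min_le_right _ _))
  have hU1 : U ≤ U₁ := hUle.trans ((min_le_left _ _).trans (min_le_left _ _))
  have hU2 : U ≤ U₂ := hUle.trans ((min_le_left _ _).trans (min_le_right _ _))
  have hU4 : U ≤ U₄ := hUle.trans ((min_le_right _ _).trans (min_le_left _ _))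
  have hUC : U ≤ klCurveU0 R := hUle.trans ((min_le_right _ _).trans (min_le_right _ _))
  have hβ : 0 < β := lt_of_lt_of_le (by unfold klBetaMin; norm_num) hβmin
  -- `0 ≤ Ms 1` (it bounds a nonnegative pinned sum)
  have hMs10 : 0 ≤ Ms 1 := by
    refine le_trans (mul_nonneg (imagTimeWeight_nonneg hβ.le M) (sum_nonneg fun x _ => ?_)) (hMs 1 (by norm_num) 0 0)
    positivity
  refine ⟨⟨?_, fun j hj q => ?_⟩, ?_, ?_⟩
  · have h := hsm c hc hc1 U hU hU1 β hβmin hβc μ hμ μ K hK L M (n + 1)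
    exact_mod_cast h.2 4
  · exact (twoLegPieceV13_tier1_size_le_of_position_moments (L := L) (M := M) hR hc hcC hU hUC hβmin hβc hμ hK n hMs hj
      (fun l hl x => hX l (hl.trans hj) x) q).trans (hfitS j hj)
  · -- (E3c), increment-resolved, from position data
    refine hlip c hc hc2 U hU hU2 β hβmin hβc μ hμ K hK L M hist G Q n (2 * Ms 1) (2 * ρfr) (by positivity)
      (norm_fderiv_increment_le_of_position_moment hβ U μ K n (hMs 1 (by norm_num))) (fun K' hK' hh θ => ?_) ?_
    · have h := abs_increment_eval_sub_le_of_position_moment (L := L) (M := M) hβ U μ K K' n (hρ K' hK' hh) (klFermiPoint μ K' θ)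
      linarith
    · have : 2 * Ms 1 / Dlip = 2 * Ms 1 / Dlip := rfl
      linarith
  · exact hsl c hc hc4 U hU hU4 β hβmin hβc μ hμ K hK L M (n + 1) Ms₁ Mt hMs₁0 hMs₁ hMt hfit1 hfit2

end Summit.HubbardSuperconductivity.HubbardSuperconductivity.Theorems.KLRegimeSplit

end
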